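/-
Copyright: b2b-lace packet (ENUMERATION SHARD A, gen 65; proof chain and steps A–B carved by CARVER gen 53).
[FvdH17] §5.1 Table "Ā^{ι,a,b,*}" / App. B row `(0,2)`: the ENTRY INEQUALITY for the starred element
`(Ā^{ι,*})_{0,2} = sup_y Σ_x Σ_κ T*_{1,1̲,0}(−(x+y), e_κ−(x+y), −y)` (the non-repulsive triangle whose middle line is
the unit bond `(0, e_κ)`) through the first-bond extraction `τ_{≥1,p} ≤ 2dp (D ⋆ τ_p)`, the landed Fourier cell
`(D^{⋆2} ⋆ τ_p^{⋆2})(y) ≤ Γ̄₂² K_{2,2}(y)` and `K_{2,2}(y) ≤ K_{2,2}(0)`.  Proofs only; no named fact; no numeral;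
no dimension.
-/
import Literature.Probability.FitznerVanDerHofstad2017.NobleEntryAbarIotaTwoTwo
import Literature.Probability.FitznerVanDerHofstad2017.NobleElementsClosedForms
import Literature.Probability.FitznerVanDerHofstad2017.NobleBoundsN1Cls22
import Literature.Probability.FitznerVanDerHofstad2017.UnitVectorPairSums
import Literature.Probability.Percolation.InfraredBoundTriangle
import HarnessLib

/-!
# [FvdH17] §5.1 / App. B: the starred entry `(Ā^{ι,*})_{0,2}` — the triangle `T*_{1,1̲,0}` by the `K`-route

Reproduction module (build `lace`, LEAN-IN-TREE RULE) in the package of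
R. Fitzner, R. van der Hofstad, *Mean-field behavior for nearest-neighbor percolation in `d > 10`*,
Electron. J. Probab. **22** (2017) no. 43 [FvdH17] (arXiv:1506.07977v2): §5.1 Table "`Ā^{ι,a,b,*}`" (p. 47) and
"Elements of the bounds" (p. 49), App. B Table "definition of `Ā^{ι,a,b}(0,v,x,y)`", row `(0,2)` (p. 78), §4.2 (4.1),
(4.3), (4.8), (4.10) (pp. 34–35), (5.1) (p. 46); and of
R. Fitzner, R. van der Hofstad, *Generalized approach to the non-backtracking lace expansion*,
Probab. Theory Relat. Fields **169** (2017) [NoBLE17] (arXiv:1506.07969): §5.3.1 "Simple diagrams", (5.26) and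
the bound `(D^{⋆m} ⋆ τ_p^{⋆n})(x) ≤ Γ̄₂ⁿ K_{n,m}(x)` (pp. 1093–1094), with `sup_x K_{n,l}(x) = K_{n,l}(0)` ((3.34),
(3.36) p. 1071).

The tree's closed form of the entry (`NobleElementsClosedForms.matAbarIotaSt_zero_two`) is
`(Ā^{ι,*})_{0,2} = sup_y Σ_x Σ_κ T*_{≥1,1̲,≥0}(−(x+y), e_κ−(x+y), −y)` for any letter table, with
`T*_{j₁,j₂,j₃}(x₁,x₂,x₃) = τ_{j₁}(x₁) τ_{j₂}(x₂−x₁) τ_{j₃}(x₃−x₂)`.  At the percolation instance `Letters.perc d p`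
the summand is `τ_{≥1,p}(−(x+y)) · p · τ_p(x − e_κ)` (`perc_tau_eq_one_stepVec`, `perc_tau_ge`, `tauGe_zero_eq_tau`;
`perc_abarIotaSt02_summand_eq`).  The bound is the ALL-`y` `K`-route:

* §A: the first-bond extraction [FvdH17] (4.3) at `m = 0`, `τ_{≥1,p}(z) ≤ 2dp (D ⋆ τ_p)(z)` for every `z`
  (`tauGe_succ_le_srwStep_conv` of `NonRepulsiveDiagramBounds`), real form `tauGe_one_le_two_d_mul_latticeConv_tau`;
* §B: the real-side identities `Σ_x g(x+y) τ_p(x−e) = (τ_p ⋆ g)(e+y)`, `Σ_κ G(e_κ+y) = 2d (D ⋆ G)(y)`, the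
  summability of `x ↦ (D ⋆ τ_p)(x+y) τ_p(x−e)` for `p < p_c`, and the re-association
  `D ⋆ (τ_p ⋆ (D ⋆ τ_p)) = D^{⋆2} ⋆ τ_p^{⋆2}` in the convolution algebra of `ℓ¹ ∩ ℓ^∞` kernels
  (`latticeConv_assoc_of_bdd`, `latticeConv_latticeConv_comm₄`), whence
  `Σ_x Σ_κ (D ⋆ τ_p)(x+y) τ_p(x−e_κ) = 2d (D^{⋆2} ⋆ τ_p^{⋆2})(y)` (`tsum_abarIotaSt02_majorant_eq`);
* §C: the `y`-member of the entry is at most `ofReal ((2dp)² (D^{⋆2} ⋆ τ_p^{⋆2})(y))`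
  (`ENNReal.ofReal_tsum_of_nonneg`, evenness of `D ⋆ τ_p`), then the LANDED simple-diagram cell
  `srwConvTau_le_nobleSup2_pow_mul_srwK` (`n = 2`, `m = 2`, needs `2·2+1 ≤ d`) and `srwK_le_srwK_zero`
  (`perc_abarIotaSt02_member_le`), and `iSup_le`:
  **`perc_matAbarIotaSt_zero_two_le_ofReal_sup2 : matAbarIotaSt (Letters.perc d p) 0 2 ≤ ofReal ((2dp)² · Γ̄₂² · K_{2,2}(0))`**
  (`Γ̄₂ = nobleSup2 d p`; `5 ≤ d`, `p < p_c`);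
* **`perc_matAbarIotaSt_zero_two_le_ofReal`** — the PRINTED form
  `matAbarIotaSt (Letters.perc d p) 0 2 ≤ ofReal ((2dp)² · (((2d−2)/(2d−1)) Γ₂)² · K_{2,2}(0))` under `nobleF2 d p ≤ Γ₂`
  (`nobleSup2_le_of_nobleF2_le`), and `perc_matAbarIotaSt_zero_two_le_ofReal_printed` with
  `(2dp)² ≤ ((2d/(2d−1)) Γ₁)²` under `(2d−1) p ≤ Γ₁` (`two_d_mul_le_of_le`).

Any `d ≥ 5`, `p < p_c(ℤ^d)`; nothing is evaluated; no named fact; all theorems kernel-checked modulo the standard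
axioms.  The identification with the notebook numerals is NOT part of this module.

[cite: FitznerVanDerHofstad2017, §5.1 Table "Ā^{ι,a,b,*}" (arXiv:1506.07977v2 p. 47); §5.1 "Elements of the bounds" (p. 49); App. B Table Ā^{ι,a,b} row (0,2) (p. 78); §4.2 (4.3), (4.8), (4.10) (pp. 34–35); (5.1) (p. 46)]
[cite: FitznerVanDerHofstad2016NoBLE, §5.3.1 (5.26) and the display before it (PTRF 169 (2017) pp. 1093–1094); (3.34), (3.36) (p. 1071); (1.1)–(1.3); (2.6)]
-/

noncomputable section

namespace Literature.Probability.FitznerVanDerHofstad2017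

open MeasureTheory Finset
open scoped BigOperators ENNReal
open Literature.Probability.LatticeModels Literature.Probability.Percolation
open Literature.Barriers.CriticalPhenomena
open Literature.Barriers.CriticalPhenomena.SpreadOutIsing (latticeConv convPow latticeConv_comm convPow_one_eq
  latticeConv_assoc_of_bdd abs_latticeConv_le_of_bdd)
open Literature.Probability.FitznerVanDerHofstad2017.NobleBlocks

variable {d : ℕ}

/-! ## A. The summand at the percolation instance and the first-bond extraction -/

/-- The summand of `(Ā^{ι,*})_{0,2}` at `Letters.perc d p`:
`T*_{≥1,1̲,≥0}(−(x+y), e_κ−(x+y), −y) = τ_{≥1,p}(−(x+y)) · p · τ_p(x − e_κ)` — the line `x+y ←≥1→ 0` read at `−(x+y)`,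
the unit bond `(0, e_κ)` (`τ_{1̲}(e_κ) = p`, `perc_tau_eq_one_stepVec`) and the line `e_κ ←≥0→ x` (`τ_{≥0,p} = τ_p`,
`perc_tau_ge`, `tauGe_zero_eq_tau`).
[cite: FitznerVanDerHofstad2017, App. B Table Ā^{ι,a,b} row (0,2) (arXiv:1506.07977v2 p. 78); §4.2 (4.1), (4.8) (p. 34); §5.1 Table "Ā^{ι,a,b,*}" (p. 47)] -/
theorem perc_abarIotaSt02_summand_eq (p : unitInterval) (κ : Fin d × Bool) (x y : Site d) :
    (Letters.perc d p).Tst (.ge 1) (.eq 1) (.ge 0) (-(x + y)) (Percolation.stepVec κ - (x + y)) (-y) =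
      ENNReal.ofReal (tauGe d p 1 (-(x + y))) * ENNReal.ofReal p *
        ENNReal.ofReal (tau d p 0 (x - Percolation.stepVec κ)) := by
  have e2 : Percolation.stepVec κ - (x + y) - -(x + y) = Percolation.stepVec κ := by abel
  have e3 : -y - (Percolation.stepVec κ - (x + y)) = x - Percolation.stepVec κ := by abel
  simp only [Letters.Tst, Letters.Bst, e2, e3]
  rw [perc_tau_eq_one_stepVec, perc_tau_ge, perc_tau_ge, tauGe_zero_eq_tau]

/-- **[FvdH17] (4.3) at `m = 0`, real form**: `τ_{≥1,p}(z) ≤ 2dp · (D ⋆ τ_p)(z)` for every `z` (the first-bond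
extraction `tauGe_succ_le_srwStep_conv` with `τ_{≥0,p} = τ_p`). `1 ≤ d`.
[cite: FitznerVanDerHofstad2017, §4.2 (4.3) (arXiv:1506.07977v2 p. 34; EJP 22 (2017) no. 43 p. 31)] -/
theorem tauGe_one_le_two_d_mul_latticeConv_tau (hd : 1 ≤ d) (p : unitInterval) (z : Site d) :
    tauGe d p 1 z ≤ 2 * d * (p : ℝ) * latticeConv (srwStep d) (tau d p 0) z := by
  have h0 : tauGe d p 0 = tau d p 0 := funext (tauGe_zero_eq_tau p)
  rw [← h0]
  exact tauGe_succ_le_srwStep_conv hd p 0 z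

/-! ## B. Real-side identities: the shift, the neighbour sum, summability, re-association -/

/-- `Σ_x g(x + y) τ_p(x − e) = (τ_p ⋆ g)(e + y)` for any `g : ℤ^d → ℝ` (the substitution `x = e − v` and the evenness
`τ_p(−v) = τ_p(v)`; no summability is needed, both sides being the same `tsum` up to a bijection of `ℤ^d`).
[cite: FitznerVanDerHofstad2016NoBLE, (1.2)–(1.3) (lattice convolution); §5.3.1 (PTRF 169 (2017) p. 1093)] -/
theorem tsum_shift_mul_tau_eq_latticeConv (p : unitInterval) (g : Site d → ℝ) (e y : Site d) :
    ∑' x, g (x + y) * tau d p 0 (x - e) = latticeConv (tau d p 0) g (e + y) := by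
  unfold latticeConv
  rw [← (Equiv.subLeft e).tsum_eq fun x => g (x + y) * tau d p 0 (x - e)]
  refine tsum_congr fun v => ?_
  simp only [Equiv.subLeft_apply]
  rw [show e - v - e = -v by abel, tau_zero_neg, show e - v + y = e + y - v by abel, mul_comm]

open Literature.Probability.FitznerVanDerHofstad2017.UnitVectorPairs (opp opp_opp) in
/-- `Σ_κ G(e_κ + y) = 2d · (D ⋆ G)(y)` (`D = srwStep d`; re-index `κ ↦ opp κ`, `e_{opp κ} = −e_κ`, then
`sum_stepVec_eq_two_d_mul_latticeConv_srwStep`). `1 ≤ d`.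
[cite: FitznerVanDerHofstad2016NoBLE, (1.1) (D(x) = 𝟙{|x| = 1}/(2d)); §5.3.1 (PTRF 169 (2017) p. 1093)] -/
theorem sum_stepVec_add_eq_two_d_mul_latticeConv_srwStep (hd : 1 ≤ d) (G : Site d → ℝ) (y : Site d) :
    ∑ κ : Fin d × Bool, G (Percolation.stepVec κ + y) = 2 * d * latticeConv (srwStep d) G y := by
  have hopp : ∀ κ : Fin d × Bool, (Percolation.stepVec (opp κ) : Site d) = -Percolation.stepVec κ := by
    rintro ⟨i, b⟩; cases b <;> simp [Percolation.stepVec, opp]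
  let e : Fin d × Bool ≃ Fin d × Bool := ⟨opp, opp, opp_opp, opp_opp⟩
  rw [← sum_stepVec_eq_two_d_mul_latticeConv_srwStep hd G y, ← Equiv.sum_comp e]
  refine Finset.sum_congr rfl fun κ _ => ?_
  show G (Percolation.stepVec (opp κ) + y) = G (y - Percolation.stepVec κ)
  rw [hopp, neg_add_eq_sub]

/-- `Σ_x Σ_κ g(x + y) τ_p(x − e_κ) = 2d · (D ⋆ (τ_p ⋆ g))(y)` whenever each `x ↦ g(x + y) τ_p(x − e_κ)` is summable
(swap the finite and the infinite sum, then `tsum_shift_mul_tau_eq_latticeConv` and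
`sum_stepVec_add_eq_two_d_mul_latticeConv_srwStep`). `1 ≤ d`.
[cite: FitznerVanDerHofstad2016NoBLE, (1.1)–(1.3); §5.3.1 (PTRF 169 (2017) p. 1093)] -/
theorem tsum_sum_shift_mul_tau_eq (hd : 1 ≤ d) (p : unitInterval) (g : Site d → ℝ) (y : Site d)
    (hsum : ∀ κ : Fin d × Bool, Summable fun x => g (x + y) * tau d p 0 (x - Percolation.stepVec κ)) :
    ∑' x, ∑ κ : Fin d × Bool, g (x + y) * tau d p 0 (x - Percolation.stepVec κ)
      = 2 * d * latticeConv (srwStep d) (latticeConv (tau d p 0) g) y := by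
  rw [Summable.tsum_finsetSum fun κ _ => hsum κ]
  simp_rw [tsum_shift_mul_tau_eq_latticeConv]
  exact sum_stepVec_add_eq_two_d_mul_latticeConv_srwStep hd _ y

set_option maxHeartbeats 800000 in
/-- Summability of `x ↦ (D ⋆ τ_p)(x + y) τ_p(x − e)` for `p < p_c` (`τ_p` summable, `summable_tau_of_lt_criticalProb`;
`D ⋆ τ_p` summable and non-negative, `summable_latticeConv`; `summable_latticeConv_inner` transported by `x ↦ −x`).
`2 ≤ d`. [cite: FitznerVanDerHofstad2016NoBLE, §5.3.1 (PTRF 169 (2017) p. 1093)] -/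
theorem summable_conv_shift_mul_tau (hd : 2 ≤ d) (p : unitInterval) (hp : p < criticalProbI d) (e y : Site d) :
    Summable fun x => latticeConv (srwStep d) (tau d p 0) (x + y) * tau d p 0 (x - e) := by
  have hp' : (p : ℝ) < criticalProb (zdGraph d) (0 : Site d) := by
    simpa [coe_criticalProbI] using (show (p : ℝ) < (criticalProbI d : ℝ) by exact_mod_cast hp)
  have hτ : Summable fun x => tau d p 0 x := summable_tau_of_lt_criticalProb hd p hp'
  have hτ0 : ∀ x, 0 ≤ tau d p 0 x := fun x => tau_nonneg p 0 x
  have hD0 : ∀ x : Site d, 0 ≤ srwStep d x := fun x => srwStep_nonneg x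
  have hg : Summable (latticeConv (srwStep d) (tau d p 0)) := summable_latticeConv summable_srwStep hτ hD0 hτ0
  have hg0 : ∀ z, 0 ≤ latticeConv (srwStep d) (tau d p 0) z := fun z => latticeConv_nonneg hD0 hτ0 z
  have hG : Summable (fun z => latticeConv (srwStep d) (tau d p 0) (-z)) :=
    hg.comp_injective neg_injective
  have hf : Summable fun x => tau d p 0 (x - e) := (Equiv.subRight e).summable_iff.2 hτ
  have h : Summable fun x => tau d p 0 (x - e) * (fun z => latticeConv (srwStep d) (tau d p 0) (-z)) (-y - x) :=
    summable_latticeConv_inner hf hG (fun x => hτ0 _) (fun z => hg0 _) (-y)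
  refine h.congr fun x => ?_
  simp only [neg_sub, sub_neg_eq_add, mul_comm]

/-- `Σ_x Σ_κ (D ⋆ τ_p)(x + y) τ_p(x − e_κ) = 2d · (D ⋆ (τ_p ⋆ (D ⋆ τ_p)))(y)` (`tsum_sum_shift_mul_tau_eq` with
`g = D ⋆ τ_p`, summability `summable_conv_shift_mul_tau`). `2 ≤ d`, `p < p_c`.
[cite: FitznerVanDerHofstad2016NoBLE, (1.1)–(1.3); §5.3.1 (PTRF 169 (2017) p. 1093)] -/
theorem tsum_sum_conv_shift_mul_tau_eq (hd : 2 ≤ d) (p : unitInterval) (hp : p < criticalProbI d) (y : Site d) :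
    ∑' x, ∑ κ : Fin d × Bool, latticeConv (srwStep d) (tau d p 0) (x + y) * tau d p 0 (x - Percolation.stepVec κ)
      = 2 * d * latticeConv (srwStep d) (latticeConv (tau d p 0) (latticeConv (srwStep d) (tau d p 0))) y :=
  tsum_sum_shift_mul_tau_eq (by omega) p _ y fun κ => summable_conv_shift_mul_tau hd p hp _ y

/-- **Re-association** `(D ⋆ (τ_p ⋆ (D ⋆ τ_p)))(y) = (D^{⋆2} ⋆ τ_p^{⋆2})(y)` in the convolution algebra of
`ℓ¹ ∩ ℓ^∞` kernels: `D, τ_p ∈ ℓ¹` (`p < p_c`), `|τ_p| ≤ 1`, `|D ⋆ τ_p| ≤ Σ|D|`; `D ⋆ (τ_p ⋆ (D ⋆ τ_p)) = (D ⋆ τ_p) ⋆ (D ⋆ τ_p)`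
(`latticeConv_assoc_of_bdd`) `= (D ⋆ D) ⋆ (τ_p ⋆ τ_p)` (`latticeConv_latticeConv_comm₄`) `= D^{⋆2} ⋆ τ_p^{⋆2}`
(`convPow_one_eq`). `2 ≤ d`, `p < p_c`.
[cite: FitznerVanDerHofstad2017, §4.2 (4.10) (arXiv:1506.07977v2 p. 35; EJP 22 (2017) no. 43 p. 32)]
[cite: FitznerVanDerHofstad2016NoBLE, §5.3.2 first display (PTRF 169 (2017) p. 1097)] -/
theorem latticeConv_srwStep_tau_srwStep_tau_eq (hd : 2 ≤ d) (p : unitInterval) (hp : p < criticalProbI d)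
    (y : Site d) :
    latticeConv (srwStep d) (latticeConv (tau d p 0) (latticeConv (srwStep d) (tau d p 0))) y =
      latticeConv (convPow (srwStep d) 2) (convPow (tau d p 0) 2) y := by
  have hp' : (p : ℝ) < criticalProb (zdGraph d) (0 : Site d) := hp
  have hτ1 : Summable fun x => |tau d p 0 x| := (summable_tau_of_lt_criticalProb hd p hp').abs
  have hD1 : Summable fun x => |srwStep d x| := summable_srwStep.abs
  have hτbd : ∀ x, |tau d p 0 x| ≤ 1 := fun x => by
    rw [abs_of_nonneg (tau_nonneg p 0 x)]
    exact tau_le_one p 0 x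
  have hGbd : ∀ x, |latticeConv (srwStep d) (tau d p 0) x| ≤ (∑' z, |srwStep d z|) * 1 := fun x =>
    abs_latticeConv_le_of_bdd hD1 hτbd x
  rw [← latticeConv_assoc_of_bdd hD1 hτ1 hGbd y, latticeConv_latticeConv_comm₄ hD1 hτ1 hD1 hτbd y]
  show _ = latticeConv (latticeConv (convPow (srwStep d) 1) (srwStep d))
    (latticeConv (convPow (tau d p 0) 1) (tau d p 0)) y
  rw [convPow_one_eq, convPow_one_eq]

/-- **Step 3 of the `K`-route for `(Ā^{ι,*})_{0,2}`**:
`Σ_x Σ_κ (D ⋆ τ_p)(x + y) τ_p(x − e_κ) = 2d · (D^{⋆2} ⋆ τ_p^{⋆2})(y)`. `2 ≤ d`, `p < p_c`.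
[cite: FitznerVanDerHofstad2017, §4.2 (4.10) (arXiv:1506.07977v2 p. 35); §5.1 "Elements of the bounds" (p. 49)]
[cite: FitznerVanDerHofstad2016NoBLE, §5.3.1 (PTRF 169 (2017) p. 1093)] -/
theorem tsum_abarIotaSt02_majorant_eq (hd : 2 ≤ d) (p : unitInterval) (hp : p < criticalProbI d) (y : Site d) :
    ∑' x, ∑ κ : Fin d × Bool, latticeConv (srwStep d) (tau d p 0) (x + y) * tau d p 0 (x - Percolation.stepVec κ) =
      2 * d * latticeConv (convPow (srwStep d) 2) (convPow (tau d p 0) 2) y := by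
  rw [tsum_sum_conv_shift_mul_tau_eq hd p hp y, latticeConv_srwStep_tau_srwStep_tau_eq hd p hp y]

/-! ## C. The entry `(Ā^{ι,*})_{0,2}` at the percolation instance -/

/-- **The `y`-member of `(Ā^{ι,*})_{0,2}` is at most `(2dp)² Γ̄₂² K_{2,2}(0)`** at `Letters.perc d p`: pointwise
`T* ≤ ofReal (2dp (D ⋆ τ_p)(−(x+y)) · p · τ_p(x − e_κ))` (§A), evenness `(D ⋆ τ_p)(−z) = (D ⋆ τ_p)(z)`
(`latticeConv_neg`), `ENNReal.ofReal_tsum_of_nonneg`, step 3 (`tsum_abarIotaSt02_majorant_eq`), then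
`srwConvTau_le_nobleSup2_pow_mul_srwK (n := 2) (m := 2)` (`2·2+1 ≤ d`) and `srwK_le_srwK_zero`. `5 ≤ d`, `p < p_c`.
[cite: FitznerVanDerHofstad2017, §5.1 Table "Ā^{ι,a,b,*}" (arXiv:1506.07977v2 p. 47); §5.1 "Elements of the bounds" (p. 49); App. B row (0,2) (p. 78)]
[cite: FitznerVanDerHofstad2016NoBLE, §5.3.1 (5.26) and the display before it (PTRF 169 (2017) pp. 1093–1094); (3.34), (3.36) (p. 1071)] -/
theorem perc_abarIotaSt02_member_le (hd : 5 ≤ d) (p : unitInterval) (hp : p < criticalProbI d) (y : Site d) :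
    ∑' x, ∑ κ : Fin d × Bool, (Letters.perc d p).Tst (.ge 1) (.eq 1) (.ge 0) (-(x + y))
        (Percolation.stepVec κ - (x + y)) (-y) ≤
      ENNReal.ofReal ((2 * d * (p : ℝ)) ^ 2 * (nobleSup2 d p ^ 2 * srwK d 2 2 0)) := by
  have hd2 : 2 ≤ d := by omega
  have hp0 : 0 ≤ (p : ℝ) := p.2.1
  have h2dp : 0 ≤ 2 * d * (p : ℝ) := by positivity
  set G : Site d → ℝ := latticeConv (srwStep d) (tau d p 0) with hG
  have hG0 : ∀ z, 0 ≤ G z := fun z =>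
    latticeConv_nonneg (fun x => srwStep_nonneg x) (fun x => tau_nonneg p 0 x) z
  have hGneg : ∀ z, G (-z) = G z := fun z => latticeConv_neg srwStep_neg (tau_zero_neg p) z
  set c : ℝ := 2 * d * (p : ℝ) * (p : ℝ) with hc
  have hc0 : 0 ≤ c := mul_nonneg h2dp hp0
  have hnn : ∀ (x : Site d) (κ : Fin d × Bool), 0 ≤ c * (G (x + y) * tau d p 0 (x - Percolation.stepVec κ)) :=
    fun x κ => mul_nonneg hc0 (mul_nonneg (hG0 _) (tau_nonneg p 0 _))
  have hsum : Summable fun x => ∑ κ : Fin d × Bool, c * (G (x + y) * tau d p 0 (x - Percolation.stepVec κ)) :=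
    summable_sum fun κ _ => (summable_conv_shift_mul_tau hd2 p hp (Percolation.stepVec κ) y).mul_left c
  -- pointwise domination of the summand by the real majorant
  have hpt : ∀ (x : Site d) (κ : Fin d × Bool),
      (Letters.perc d p).Tst (.ge 1) (.eq 1) (.ge 0) (-(x + y)) (Percolation.stepVec κ - (x + y)) (-y) ≤
        ENNReal.ofReal (c * (G (x + y) * tau d p 0 (x - Percolation.stepVec κ))) := fun x κ => by
    rw [perc_abarIotaSt02_summand_eq]
    calc ENNReal.ofReal (tauGe d p 1 (-(x + y))) * ENNReal.ofReal p *
          ENNReal.ofReal (tau d p 0 (x - Percolation.stepVec κ))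
        ≤ ENNReal.ofReal (2 * d * (p : ℝ) * G (-(x + y))) * ENNReal.ofReal p *
          ENNReal.ofReal (tau d p 0 (x - Percolation.stepVec κ)) := by
          gcongr
          exact tauGe_one_le_two_d_mul_latticeConv_tau (by omega) p _
      _ = ENNReal.ofReal (c * (G (x + y) * tau d p 0 (x - Percolation.stepVec κ))) := by
          rw [hGneg, ← ENNReal.ofReal_mul (mul_nonneg h2dp (hG0 _)),
            ← ENNReal.ofReal_mul (mul_nonneg (mul_nonneg h2dp (hG0 _)) hp0)]
          congr 1
          simp only [hc]
          ring
  calc ∑' x, ∑ κ : Fin d × Bool, (Letters.perc d p).Tst (.ge 1) (.eq 1) (.ge 0) (-(x + y))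
          (Percolation.stepVec κ - (x + y)) (-y)
      ≤ ∑' x, ∑ κ : Fin d × Bool, ENNReal.ofReal (c * (G (x + y) * tau d p 0 (x - Percolation.stepVec κ))) :=
        ENNReal.tsum_le_tsum fun x => Finset.sum_le_sum fun κ _ => hpt x κ
    _ = ENNReal.ofReal (∑' x, ∑ κ : Fin d × Bool, c * (G (x + y) * tau d p 0 (x - Percolation.stepVec κ))) := by
        rw [ENNReal.ofReal_tsum_of_nonneg (fun x => Finset.sum_nonneg fun κ _ => hnn x κ) hsum]
        exact tsum_congr fun x => (ENNReal.ofReal_sum_of_nonneg fun κ _ => hnn x κ).symm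
    _ = ENNReal.ofReal ((2 * d * (p : ℝ)) ^ 2 * latticeConv (convPow (srwStep d) 2) (convPow (tau d p 0) 2) y) := by
        congr 1
        have h1 : ∑' x, ∑ κ : Fin d × Bool, c * (G (x + y) * tau d p 0 (x - Percolation.stepVec κ)) =
            c * ∑' x, ∑ κ : Fin d × Bool, G (x + y) * tau d p 0 (x - Percolation.stepVec κ) := by
          rw [← tsum_mul_left]
          exact tsum_congr fun x => (Finset.mul_sum _ _ c).symm
        rw [h1, hG, tsum_abarIotaSt02_majorant_eq hd2 p hp y, hc]
        ring
    _ ≤ ENNReal.ofReal ((2 * d * (p : ℝ)) ^ 2 * (nobleSup2 d p ^ 2 * srwK d 2 2 0)) := by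
        refine ENNReal.ofReal_le_ofReal (mul_le_mul_of_nonneg_left ?_ (pow_nonneg h2dp 2))
        exact (srwConvTau_le_nobleSup2_pow_mul_srwK (n := 2) (by omega) (by omega) p hp 2 y).trans
          (mul_le_mul_of_nonneg_left (srwK_le_srwK_zero (n := 2) (by omega) 2 y)
            (pow_nonneg (nobleSup2_nonneg' p) 2))

/-- **`(Ā^{ι,*})_{0,2} ≤ (2dp)² · Γ̄₂² · K_{2,2}(0)`** at `Letters.perc d p` (`Γ̄₂ = nobleSup2 d p`): the closed form
`matAbarIotaSt_zero_two`, the member bound `perc_abarIotaSt02_member_le` for every `y`, and `iSup_le`. `5 ≤ d`, `p < p_c`.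
[cite: FitznerVanDerHofstad2017, §5.1 Table "Ā^{ι,a,b,*}" (arXiv:1506.07977v2 p. 47); §5.1 "Elements of the bounds" (p. 49); App. B row (0,2) (p. 78)]
[cite: FitznerVanDerHofstad2016NoBLE, §5.3.1 (5.26) and the display before it (PTRF 169 (2017) pp. 1093–1094); (3.34), (3.36) (p. 1071)] -/
theorem perc_matAbarIotaSt_zero_two_le_ofReal_sup2 (hd : 5 ≤ d) (p : unitInterval) (hp : p < criticalProbI d) :
    matAbarIotaSt (Letters.perc d p) 0 2 ≤
      ENNReal.ofReal ((2 * d * (p : ℝ)) ^ 2 * (nobleSup2 d p ^ 2 * srwK d 2 2 0)) := by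
  rw [matAbarIotaSt_zero_two]
  exact iSup_le fun y => perc_abarIotaSt02_member_le hd p hp y

/-- **The PRINTED entry inequality for `(Ā^{ι,*})_{0,2}`**:
`matAbarIotaSt (Letters.perc d p) 0 2 ≤ ofReal ((2dp)² · (((2d−2)/(2d−1)) Γ₂)² · K_{2,2}(0))` under `nobleF2 d p ≤ Γ₂`
(`Γ̄₂ ≤ ((2d−2)/(2d−1)) Γ₂`, `nobleSup2_le_of_nobleF2_le`). `5 ≤ d`, `p < p_c`.
[cite: FitznerVanDerHofstad2017, §5.1 Table "Ā^{ι,a,b,*}" (arXiv:1506.07977v2 p. 47); §5.1 "Elements of the bounds" (p. 49); App. B row (0,2) (p. 78); (5.1) (p. 46)]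
[cite: FitznerVanDerHofstad2016NoBLE, §5.3.1 (5.26) (PTRF 169 (2017) p. 1094); (2.6)] -/
theorem perc_matAbarIotaSt_zero_two_le_ofReal (hd : 5 ≤ d) (p : unitInterval) (hp : p < criticalProbI d) {Γ₂ : ℝ}
    (hΓ2 : nobleF2 d p ≤ Γ₂) :
    matAbarIotaSt (Letters.perc d p) 0 2 ≤
      ENNReal.ofReal ((2 * d * (p : ℝ)) ^ 2 * (((2 * d - 2) / (2 * d - 1) * Γ₂) ^ 2 * srwK d 2 2 0)) := by
  have h2dp : 0 ≤ 2 * d * (p : ℝ) := by have := p.2.1; positivity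
  exact (perc_matAbarIotaSt_zero_two_le_ofReal_sup2 hd p hp).trans (ENNReal.ofReal_le_ofReal
    (mul_le_mul_of_nonneg_left (mul_le_mul_of_nonneg_right
      (pow_le_pow_left₀ (nobleSup2_nonneg' p) (nobleSup2_le_of_nobleF2_le (by omega) p hΓ2) 2) (srwK_nonneg 2 2 0))
      (pow_nonneg h2dp 2)))

/-- **The PRINTED entry inequality for `(Ā^{ι,*})_{0,2}`, both constants**:
`matAbarIotaSt (Letters.perc d p) 0 2 ≤ ofReal (((2d/(2d−1)) Γ₁)² · (((2d−2)/(2d−1)) Γ₂)² · K_{2,2}(0))` under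
`(2d−1) p ≤ Γ₁` (`2dp ≤ (2d/(2d−1)) Γ₁`, `two_d_mul_le_of_le`) and `nobleF2 d p ≤ Γ₂`. `5 ≤ d`, `p < p_c`.
[cite: FitznerVanDerHofstad2017, §5.1 Table "Ā^{ι,a,b,*}" (arXiv:1506.07977v2 p. 47); §5.1 "Elements of the bounds" (p. 49); App. B row (0,2) (p. 78); (5.1) (p. 46)]
[cite: FitznerVanDerHofstad2016NoBLE, §5.3.1 (5.13), (5.26) (PTRF 169 (2017) pp. 1092–1094); (2.6)] -/
theorem perc_matAbarIotaSt_zero_two_le_ofReal_printed (hd : 5 ≤ d) (p : unitInterval) (hp : p < criticalProbI d)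
    {Γ₁ Γ₂ : ℝ} (hΓ1 : (2 * d - 1) * (p : ℝ) ≤ Γ₁) (hΓ2 : nobleF2 d p ≤ Γ₂) :
    matAbarIotaSt (Letters.perc d p) 0 2 ≤
      ENNReal.ofReal ((2 * d / (2 * d - 1) * Γ₁) ^ 2 * (((2 * d - 2) / (2 * d - 1) * Γ₂) ^ 2 * srwK d 2 2 0)) := by
  have h2dp : 0 ≤ 2 * d * (p : ℝ) := by have := p.2.1; positivity
  exact (perc_matAbarIotaSt_zero_two_le_ofReal hd p hp hΓ2).trans (ENNReal.ofReal_le_ofReal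
    (mul_le_mul_of_nonneg_right (pow_le_pow_left₀ h2dp (two_d_mul_le_of_le (by omega) p hΓ1) 2)
      (mul_nonneg (sq_nonneg _) (srwK_nonneg 2 2 0))))

end Literature.Probability.FitznerVanDerHofstad2017
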